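import Mathlib
import Literature.AlgebraicGeometry.Motives.CrystallineRealization
import Literature.AlgebraicGeometry.Motives.AbelianVariety
import Summits.HodgeConjecture.HodgeConjecture.Theses.PadicSemiregularLift

/-!
# Sketch (crux-ideate, ideator 3, round 1) — crux `HodgeAbelianVarieties` (stmt-HodgeConjecture-1333)

First lemmas of the two idea cards, stated over existing declarations (no proofs required at this
stage; everything here must only ELABORATE).

* Card `greenberg-finite-depth-seeds`: `GreenbergLifting` (Greenberg 1966, strong approximation,
  scheme form over `W(k)`), and its rank-one calibration inside the tree's `WittScheme` vocabulary,
  `LevelwiseLiftingRankOne C` (level-wise, INCOMPATIBLE lifts of a line bundle to every `X_{n+1}`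
  already force a formal lift — Berthelot–Ogus 3.8 + separatedness of `H²(𝒳,𝒪)`).
* Card `inner-form-invariant-seeds`: `InvariantsBaseChange` (invariants of a family of operators
  commute with extension of scalars — the algebraic heart of "`U^{I_x} ⊗ ℚ_p = (U ⊗ ℚ_p)^{J_b}`"),
  and the typed form of the card's residual crux `RationalPVHCAtAnchors C` (rational special-fibre
  classes that are Hodge on the generic fibre of an abelian `W(k)`-model with cohomologically
  supersingular special fibre are algebraic on the generic fibre).
-/

set_option linter.dupNamespace false

noncomputable section

namespace Summit.HodgeConjecture.HodgeConjecture.Cruxes.HodgeAbelianVarieties.IdeatorThreeSketch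

open CategoryTheory AlgebraicGeometry
open scoped TensorProduct Isocrystal
open Literature.AlgebraicGeometry.Motives

universe u

/-! ## Card A — Greenberg's theorem (scheme form) and the rank-one calibration -/

/-- **Greenberg 1966 (corollary of strong approximation), scheme form over `W(k)`.** For `k` a perfect
field of characteristic `p` and `Y → Spec W(k)` of finite type: if `Y` has a `W_{n+1} = W/p^{n+1}`-point
over `W` for every `n`, then `Y` has a `W`-point (a section). No compatibility between the level-wise
points is assumed — that is the whole content. -/
def GreenbergLifting : Prop :=
  ∀ (p : ℕ) [Fact p.Prime] (k : Type) [Field k] [CharP k p] [PerfectRing k p]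
    (Y : Scheme.{0}) (f : Y ⟶ Spec (CommRingCat.of (WittVector p k)))
    [LocallyOfFiniteType f] [QuasiCompact f],
    (∀ n : ℕ, ∃ s : Spec (CommRingCat.of (wittQuot p k (n + 1))) ⟶ Y,
        s ≫ f = Spec.map (CommRingCat.ofHom
          (algebraMap (WittVector p k) (wittQuot p k (n + 1))))) →
    ∃ s : Spec (CommRingCat.of (WittVector p k)) ⟶ Y, s ≫ f = 𝟙 _

variable {p : ℕ} [Fact p.Prime] {k : Type u} [Field k] [CharP k p] [PerfectRing k p]

/-- **Rank-one calibration of the finite-depth lever** (a property of the classical crystalline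
realization, consumed as a hypothesis like `BerthelotOgusLineBundleLifting C`): on a smooth proper
`𝒳/W`, `p ≠ 2`, `H²(𝒳,𝒪)` without `p`-torsion, a line bundle on `X_k` that lifts to EACH thickening
`X_{n+1}` separately (lifts not required to be compatible) lifts formally. Paper proof: a lift to
`X_{n+1}` kills the Berthelot–Ogus obstruction modulo `pⁿ`; `H²(𝒳,𝒪)` is `p`-adically separated, so the
obstruction is `0`, i.e. `c₁ ∈ F¹`, and Berthelot–Ogus 3.8 gives the formal lift. -/
def LevelwiseLiftingRankOne (C : CrystallineRealization p k) : Prop :=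
  ∀ ⦃n : ℕ⦄ ⦃𝒳 : SchemeOver (WittVector p k)⦄, WittScheme.IsSmoothProperModel n 𝒳 → p ≠ 2 →
    (∀ x : structureSheafCohomology 𝒳.left 2, (p : ℤ) • x = 0 → x = 0) →
    ∀ (L : (WittScheme.specialFibre 𝒳).left.Modules), HasRank L 1 →
      (∀ m : ℕ, WittScheme.LiftsToThickening 𝒳 L m) → WittScheme.LiftsFormally 𝒳 L

/-- The calibration follows from Berthelot–Ogus lifting plus the level-wise obstruction analysis;
recorded as the shape of the first stub of the line (level-wise ⇒ Hodge condition is the part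
needing the integral comparison the tree does not have). -/
def LevelwiseHodgeConditionRankOne (C : CrystallineRealization p k) : Prop :=
  ∀ ⦃n : ℕ⦄ ⦃𝒳 : SchemeOver (WittVector p k)⦄, WittScheme.IsSmoothProperModel n 𝒳 → p ≠ 2 →
    (∀ x : structureSheafCohomology 𝒳.left 2, (p : ℤ) • x = 0 → x = 0) →
    ∀ (L : (WittScheme.specialFibre 𝒳).left.Modules), HasRank L 1 →
      (∀ m : ℕ, WittScheme.LiftsToThickening 𝒳 L m) →
        C.bo 𝒳 (2 * 1) (C.chCris (WittScheme.specialFibre 𝒳) L 1) ∈ C.dR.fil (2 * 1) 1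

theorem levelwiseLiftingRankOne_of (C : CrystallineRealization p k)
    (hBO : C.BerthelotOgusLineBundleLifting) (hLev : LevelwiseHodgeConditionRankOne C) :
    LevelwiseLiftingRankOne C := by
  intro n 𝒳 h𝒳 hp hH L hL hlev
  exact (hBO h𝒳 hp hH L hL).mpr (hLev h𝒳 hp hH L hL hlev)

/-! ## Card B — invariants commute with base change; rational p-adic variational Hodge at anchors -/

/-- **Invariants commute with extension of scalars.** For a family of `K`-linear operators `ρ i` on a
`K`-space `V` and a field extension `L/K`, the common fixed space of the base-changed operators on
`L ⊗ V` is the base change of the common fixed space. (Pure linear algebra: kernels and arbitrary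
intersections of submodules commute with the exact functor `L ⊗_K –`, `L` being free over `K`.) This is
the algebraic heart of `U^{I_x} ⊗ ℚ_p = (U ⊗ ℚ_p)^{I_x(ℚ_p)}` in the card. -/
def InvariantsBaseChange : Prop :=
  ∀ (K L V : Type) [Field K] [Field L] [Algebra K L] [AddCommGroup V] [Module K V]
    (ι : Type) (ρ : ι → V →ₗ[K] V),
    (⨅ i, LinearMap.ker ((ρ i).baseChange L - LinearMap.id) : Submodule L (L ⊗[K] V)) =
      (⨅ i, LinearMap.ker (ρ i - LinearMap.id)).baseChange L

/-- **Cohomologically supersingular special fibre** (the route's anchor notion, rationally): every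
class of `H²ʳ(X_k) = H²ʳ_cris ⊗ K` is a `K`-combination of classes of `ℚ`-cycles, for every `r`. -/
def IsCohomologicallySupersingular (C : CrystallineRealization p k) (X : SchemeOver k) : Prop :=
  ∀ r : ℕ, Submodule.span K(p, k) (C.ratAlgebraicClasses X r : Set (C.obj X (2 * r))) = ⊤

/-- **Rational p-adic variational Hodge at abelian anchors** (the card's residual crux, typed over the
tree's real `WittScheme` vocabulary and the hypothesis structure `CrystallineRealization`): let `𝒳/W(k)`
be a smooth proper model whose special fibre is (the underlying scheme of) an abelian variety `A/k`
that is cohomologically supersingular; then every RATIONAL algebraic class `u` of the special fibre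
whose Berthelot–Ogus image lies in `Fʳ H²ʳ_dR(X_K/K)` is a `K`-combination of classes of `ℚ`-cycles of
the generic fibre. (Fontaine–Messing / Bloch–Esnault–Kerz Conjecture 2 restricted to rational classes
and to abelian anchors; the card explains why, at DOUBLY GENERIC lifts, this is equivalent to the crux.) -/
def RationalPVHCAtAnchors (C : CrystallineRealization p k) : Prop :=
  ∀ ⦃d : ℕ⦄ ⦃𝒳 : SchemeOver (WittVector p k)⦄ (A : AbelianVariety k),
    WittScheme.IsSmoothProperModel d 𝒳 → A.X = WittScheme.specialFibre 𝒳 →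
    IsCohomologicallySupersingular C (WittScheme.specialFibre 𝒳) →
    ∀ (r : ℕ) (u : C.obj (WittScheme.specialFibre 𝒳) (2 * r)),
      u ∈ C.ratAlgebraicClasses (WittScheme.specialFibre 𝒳) r →
      C.bo 𝒳 (2 * r) u ∈ C.dR.fil (2 * r) r →
      C.bo 𝒳 (2 * r) u ∈ Submodule.span K(p, k)
        (C.dR.ratAlgebraicClasses (WittScheme.genericFibre 𝒳) r : Set (C.dR.obj (WittScheme.genericFibre 𝒳) (2 * r)))

/-- Sanity link with the tree: a class that IS the Chern character of a bundle lifting to `𝒳`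
satisfies the conclusion of `RationalPVHCAtAnchors` (known direction; `bo_chCris` +
`chDR_mem_ratAlgebraicClasses`). -/
theorem bo_chCris_mem_span (C : CrystallineRealization p k) {d : ℕ} {𝒳 : SchemeOver (WittVector p k)}
    (h𝒳 : WittScheme.IsSmoothProperModel d 𝒳) (E : 𝒳.left.Modules) (hE : IsVectorBundle E) (r : ℕ) :
    C.bo 𝒳 (2 * r) (C.chCris (WittScheme.specialFibre 𝒳) (WittScheme.restrictSpecial 𝒳 E) r) ∈
      Submodule.span K(p, k)
        (C.dR.ratAlgebraicClasses (WittScheme.genericFibre 𝒳) r :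
          Set (C.dR.obj (WittScheme.genericFibre 𝒳) (2 * r))) := by
  rw [C.bo_chCris h𝒳 E hE r]
  exact Submodule.subset_span (C.chDR_mem_ratAlgebraicClasses h𝒳.isSmoothProjective_genericFibre _ r)

/-- The crux, by name (so that a later skeleton's `HodgeAbelianVarieties_of` has its target in scope). -/
example : Prop := Summit.HodgeConjecture.HodgeConjecture.Theses.PadicSemiregularLift.HodgeAbelianVarieties

end Summit.HodgeConjecture.HodgeConjecture.Cruxes.HodgeAbelianVarieties.IdeatorThreeSketch

end
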